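import Summits.FinalStateConjecture.FinalStateConjecture.Theses.ExactKerrEnds
import Summits.FinalStateConjecture.FinalStateConjecture.Theorems.ExactKerrEndsCensorshipAlongKerrEndsWindowUpgrade

/-!
# Strength finding (strategist gen 1, 2026-08-17): the two COMPACT EXITS of line `Sketch` v4, together with
# `MGHDExists`, already prove the SUMMIT — kernel-checked appendix to `STRATEGY-CENSUS.md` §Decomposition

Line `Sketch` v4 (lead c4; tree `Cruxes/CensorshipAlongKerrEnds/Lines/Sketch.lean`) reduces the crux
`CensorshipAlongKerrEnds` (C₁, stmt-FinalStateConjecture-18521) to four open registered stubs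
(`stub_compactNakedExit`, `stub_compactCensoredExit`, `stub_matchedKerrGluingCurve` = crux E's atom,
`stub_reEndingAbsorptionC`) plus the route items `MGHDExists` / `AdmissibleMassNonneg` /
`ZeroMassAdmissibleMinkowskian`; every other stub is landed (p148379, p148292, p153977, p166170, radial p≈14:29Z,
patch 14:36Z).

This file records, sorry-free, that the FIRST TWO of those four open pieces are jointly summit-strength:

  `finalStateConjecture_of_compactExits : MGHDExists → CompactNakedExit → CompactCensoredExit → FinalStateConjecture`

(`CompactNakedExit` / `CompactCensoredExit` are VERBATIM the v4 stub statements, §2 of the skeleton, with the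
`Settled` short form expanded; the proof is a case split on the base datum plus the LANDED window upgrade
`Theorems.ExactKerrEnds.CensorshipAlongKerrEnds.stub_windowUpgrade`, p148379).  Consequence for the census: any
promotion of v4's open stubs to route items would file under route ExactKerrEnds a conjunct PAIR which, with the
shared anti-vacuity item stmt-9937, dominates the Statement `S` itself (tribunal test T1: "a dominating hypothesis
`H ⇒ C` with `H ⇒ S` alone"); the line reaches C₁ only THROUGH the summit's own generic-settling content (in
Christodoulou's compact-support form) AND two further open statements (E's gluing atom; re-ending absorption).
Neither exit alone gives `S` (the naked exit says nothing at censored-unsettled data and conversely), so per-piece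
probes pass; it is the pair that is the summit.  See STRATEGY-CENSUS.md §Decomposition D1/D5 and §Bottom line.
-/

set_option linter.dupNamespace false

noncomputable section

open Set Function Filter
open scoped Manifold ContDiff Topology

namespace Summit.FinalStateConjecture.FinalStateConjecture.Cruxes.CensorshipAlongKerrEnds.Strategist

open Literature.Geometry.Lorentzian
open Summit.FinalStateConjecture.FinalStateConjecture.Theses.ExactKerrEnds (MGHDExists)

section ShortForms

variable {X : Type} [TopologicalSpace X] [ChartedSpace E3 X] [IsManifold (𝓡 3) ∞ X] [T2Space X]
  [SecondCountableTopology X] [ConnectedSpace X]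

/-- `Settled D` — verbatim the Statement's good property (an MGHD exists; every MGHD has complete `𝓘⁺` and
an honest sub-extremal `N`-Kerr final-state decomposition). [cite: DafermosLuk2017, Conjecture 1] -/
def Settled (D : InitialDataSet (𝓡 3) X) : Prop :=
  (∃ 𝒟 : VacuumCauchyDevelopment D, 𝒟.IsMaximal) ∧
    ∀ 𝒟 : VacuumCauchyDevelopment D, 𝒟.IsMaximal →
      Summit.FinalStateConjecture.HasCompleteNullInfinity 𝒟.toCauchyDevelopment ∧
        ∃ (O : Set 𝒟.carrier) (d : FinalStateDecomposition 𝒟.toSpacetime O 2),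
          (∀ i, Kerr.IsSubextremal (d.mass i) (d.spin i)) ∧
            O = Summit.FinalStateConjecture.exteriorOf 𝒟.toCauchyDevelopment d.charted ∧
              Summit.FinalStateConjecture.RaysStayInClosure 𝒟.toCauchyDevelopment O ∧
                Summit.FinalStateConjecture.HasExhaustiveCharts d ∧
                  Summit.FinalStateConjecture.IsFutureOriented d

end ShortForms

/-- **COMPACT NAKED-DATA EXIT** — verbatim `CompactNakedExit` of `Lines/Sketch.lean` v4 §2 (registered stub
`stub_compactNakedExit`): through an admissible datum with an MGHD of incomplete `𝓘⁺` passes a tame, immersed,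
injective admissible curve of data agreeing with it off one compact set and settled on a punctured window.
[cite: Christodoulou1999, p. A24] -/
def CompactNakedExit : Prop :=
  ∀ (X : Type) [TopologicalSpace X] [ChartedSpace E3 X] [IsManifold (𝓡 3) ∞ X] [T2Space X]
    [SecondCountableTopology X] [ConnectedSpace X],
    ∀ D ∈ admissibleVacuumData X,
      (∃ 𝒟 : VacuumCauchyDevelopment D, 𝒟.IsMaximal ∧
        ¬ Summit.FinalStateConjecture.HasCompleteNullInfinity 𝒟.toCauchyDevelopment) →
      ∃ (e : AFEnd X) (F : EuclideanSpace ℝ (Fin 1) → InitialDataSet (𝓡 3) X),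
        InitialDataSet.IsTameDataFamily e 1 F ∧ InitialDataSet.IsImmersedAtZero 1 F ∧ F 0 = D ∧ Injective F ∧
          (∀ c, F c ∈ admissibleVacuumData X) ∧
          (∃ K : Set X, IsCompact K ∧ ∀ (c : EuclideanSpace ℝ (Fin 1)) (x : X), x ∉ K →
            (F c).h.inner x = D.h.inner x ∧ (F c).k x = D.k x) ∧
          ∃ ε : ℝ, 0 < ε ∧ ∀ c, c ≠ 0 → ‖c‖ < ε → Settled (F c)

/-- **COMPACT CENSORED-DATA EXIT** — verbatim `CompactCensoredExit` of `Lines/Sketch.lean` v4 §2 (registered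
stub `stub_compactCensoredExit`). [cite: DafermosLuk2017, Conjecture 1] -/
def CompactCensoredExit : Prop :=
  ∀ (X : Type) [TopologicalSpace X] [ChartedSpace E3 X] [IsManifold (𝓡 3) ∞ X] [T2Space X]
    [SecondCountableTopology X] [ConnectedSpace X],
    ∀ D ∈ admissibleVacuumData X,
      (∃ 𝒟 : VacuumCauchyDevelopment D, 𝒟.IsMaximal) →
      (∀ 𝒟 : VacuumCauchyDevelopment D, 𝒟.IsMaximal →
        Summit.FinalStateConjecture.HasCompleteNullInfinity 𝒟.toCauchyDevelopment) →
      (∃ 𝒟 : VacuumCauchyDevelopment D, 𝒟.IsMaximal ∧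
        ¬ ∃ (O : Set 𝒟.carrier) (d : FinalStateDecomposition 𝒟.toSpacetime O 2),
          (∀ i, Kerr.IsSubextremal (d.mass i) (d.spin i)) ∧
            O = Summit.FinalStateConjecture.exteriorOf 𝒟.toCauchyDevelopment d.charted ∧
              Summit.FinalStateConjecture.RaysStayInClosure 𝒟.toCauchyDevelopment O ∧
                Summit.FinalStateConjecture.HasExhaustiveCharts d ∧
                  Summit.FinalStateConjecture.IsFutureOriented d) →
      ∃ (e : AFEnd X) (F : EuclideanSpace ℝ (Fin 1) → InitialDataSet (𝓡 3) X),
        InitialDataSet.IsTameDataFamily e 1 F ∧ InitialDataSet.IsImmersedAtZero 1 F ∧ F 0 = D ∧ Injective F ∧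
          (∀ c, F c ∈ admissibleVacuumData X) ∧
          (∃ K : Set X, IsCompact K ∧ ∀ (c : EuclideanSpace ℝ (Fin 1)) (x : X), x ∉ K →
            (F c).h.inner x = D.h.inner x ∧ (F c).k x = D.k x) ∧
          ∃ ε : ℝ, 0 < ε ∧ ∀ c, c ≠ 0 → ‖c‖ < ε → Settled (F c)

/-- **The two compact exits and MGHD existence prove the summit.** For an admissible datum `d` failing the
Statement's property: `d` has an MGHD (`MGHDExists`), so some MGHD lacks completeness or the decomposition;
in the first case the naked exit, in the second the censored exit supplies a tame immersed admissible curve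
through `d` whose members are settled on a punctured window; the landed window upgrade (p148379) turns it into
the injective immersed curve with ALL non-zero members settled that tame Christodoulou genericity asks for.
Compact support is not even used. [folklore] -/
theorem finalStateConjecture_of_compactExits (hM : MGHDExists) (hN : CompactNakedExit)
    (hT : CompactCensoredExit) : FinalStateConjecture := by
  intro X _ _ _ _ _ _ d hd
  obtain ⟨hd𝓓, hbad⟩ := hd
  have hex : ∃ 𝒟 : VacuumCauchyDevelopment d, 𝒟.IsMaximal := hM X d hd𝓓
  -- a tame immersed curve through `d` with settled members on a punctured window, from one of the exits
  have hwin : ∃ (e : AFEnd X) (F : EuclideanSpace ℝ (Fin 1) → InitialDataSet (𝓡 3) X),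
      InitialDataSet.IsTameDataFamily e 1 F ∧ InitialDataSet.IsImmersedAtZero 1 F ∧ F 0 = d ∧
        (∀ c, F c ∈ admissibleVacuumData X) ∧ ∃ ε : ℝ, 0 < ε ∧ ∀ c, c ≠ 0 → ‖c‖ < ε → Settled (F c) := by
    by_cases hC : ∀ 𝒟 : VacuumCauchyDevelopment d, 𝒟.IsMaximal →
        Summit.FinalStateConjecture.HasCompleteNullInfinity 𝒟.toCauchyDevelopment
    · -- censored base: the decomposition must fail for some MGHD (else `d` would be good)
      have hS : ∃ 𝒟 : VacuumCauchyDevelopment d, 𝒟.IsMaximal ∧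
          ¬ ∃ (O : Set 𝒟.carrier) (dd : FinalStateDecomposition 𝒟.toSpacetime O 2),
            (∀ i, Kerr.IsSubextremal (dd.mass i) (dd.spin i)) ∧
              O = Summit.FinalStateConjecture.exteriorOf 𝒟.toCauchyDevelopment dd.charted ∧
                Summit.FinalStateConjecture.RaysStayInClosure 𝒟.toCauchyDevelopment O ∧
                  Summit.FinalStateConjecture.HasExhaustiveCharts dd ∧
                    Summit.FinalStateConjecture.IsFutureOriented dd := by
        by_contra hno
        push Not at hno
        exact hbad ⟨hex, fun 𝒟 h𝒟 ↦ ⟨hC 𝒟 h𝒟, hno 𝒟 h𝒟⟩⟩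
      obtain ⟨e, F, hFt, hFi, hF0, -, hFadm, -, ε, hε, hgood⟩ := hT X d hd𝓓 hex hC hS
      exact ⟨e, F, hFt, hFi, hF0, hFadm, ε, hε, hgood⟩
    · push Not at hC
      obtain ⟨𝒟, h𝒟, hno⟩ := hC
      obtain ⟨e, F, hFt, hFi, hF0, -, hFadm, -, ε, hε, hgood⟩ := hN X d hd𝓓 ⟨𝒟, h𝒟, hno⟩
      exact ⟨e, F, hFt, hFi, hF0, hFadm, ε, hε, hgood⟩
  obtain ⟨e, F, hFt, hFi, hF0, hFadm, ε, hε, hgood⟩ := hwin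
  -- window upgrade (landed, p148379) for the property "admissible ∧ settled"
  obtain ⟨F', hF't, hF'0, hF'inj, hF'i, hF'P⟩ :=
    Summit.FinalStateConjecture.FinalStateConjecture.Theorems.ExactKerrEnds.CensorshipAlongKerrEnds.stub_windowUpgrade
      X (fun D ↦ D ∈ admissibleVacuumData X ∧ Settled D) e F hFt hFi
      ⟨ε, hε, fun c hc hcε ↦ ⟨hFadm c, hgood c hc hcε⟩⟩
  refine ⟨e, F', hF't, hF'i, hF'0.trans hF0, hF'inj, fun c ↦ ?_, fun c hc hmem ↦ hmem.2 (hF'P c hc).2⟩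
  by_cases hc : c = 0
  · subst hc
    rw [hF'0, hF0]
    exact hd𝓓
  · exact (hF'P c hc).1

end Summit.FinalStateConjecture.FinalStateConjecture.Cruxes.CensorshipAlongKerrEnds.Strategist

end
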